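import Summits.AtomisticToContinuum.HydrodynamicLimit.Theorems.JParityClosureOddContactSymmetryGibbsInvariance
import Literature.MathematicalPhysics.StatisticalMechanics.SpecificRelativeEntropyProofs
import Literature.Probability.Divergences.KLDivConvexity
import Literature.MathematicalPhysics.KineticTheory.HardSphereEulerProofs
import HarnessLib

/-!
# `SwapGap` (stmt-AtomisticToContinuum-11850): pinned entropy along the deterministic flow and the
# equilibrium entropy-inequality transfer

Helper file of line `Sketch` for the crux
`Summit.AtomisticToContinuum.HydrodynamicLimit.Theses.LambertianContactSwap.SwapGap` — the two
entropy-inequality tools that the cards `dyson-around-lambertian` (first lemmas `EntropyConservation`,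
`RemainderTransfer`) and `equilibrium-superexponential-transfer` (`EquilibriumTransfer`) use to price the
DETERMINISTICALLY evolved law `(Φ_t)_* P_N` against the homogeneous (flow-invariant) Gibbs law `G_N`,
the layer-2 currency under the line's stub S1 (`RelEntSwap`):

* `klDiv_map_flow_eq_of_map_flow_eq` — **pinned entropy**: for finite laws `P, Q ≪ Liouville` on
  hard-sphere phase space and a hard-sphere flow `Φ` leaving `Q` invariant,
  `KL((Φ_t)_* P ‖ Q) = KL(P ‖ Q)` (both laws live on the good set, on which `Φ_{-t}` inverts `Φ_t`;
  transport of `klDiv` along an a.e.-invertible map, `klDiv_map_eq_of_leftInvOn`);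
* `klDiv_map_flow_localGibbsLaw_const` — the instance `P =` local Gibbs law, `Q = G_N` the homogeneous
  Gibbs law with constant profiles (invariant under every hard-sphere flow,
  `map_flow_localGibbsLaw_const`): `H((Φ_t)_* P_N | G_N) = H(P_N | G_N)` (`EntropyConservation`);
* `integral_comp_flow_le_of_klDiv` — **the equilibrium transfer (entropy inequality along the flow)**:
  for a bounded measurable `Y` and `λ > 0`,
  `∫ Y(Φ_t z) dP ≤ λ⁻¹ (KL(P ‖ Q) + log ∫ e^{λ Y} dQ)` whenever `KL(P ‖ Q) < ∞`
  (`RemainderTransfer`, bounded form: Gibbs / Donsker–Varadhan inequality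
  `integral_le_toReal_klDiv_add_log` for the image law, plus pinned entropy).

Kipnis–Landim 1999, App. 1 §8 (entropy inequality); Olla–Varadhan–Yau 1993 §3 (entropy w.r.t. the
invariant Gibbs law is conserved by the Hamiltonian part of the dynamics).
prover-line-stmt-AtomisticToContinuum-11850-0, cycle 1.
-/

noncomputable section

open MeasureTheory Filter Set Topology InformationTheory
open scoped ENNReal

namespace Summit.AtomisticToContinuum.HydrodynamicLimit.Theorems

open Literature.Analysis.FluidPDE Literature.MathematicalPhysics.KineticTheory

/-! ### Laws below Liouville do not charge the bad set

(The local Gibbs instance is `Theorems.localGibbsLaw_compl_good` of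
`JParityClosureParityInBandEnergyTight.lean`.) -/

/-- A law absolutely continuous with respect to the Liouville measure gives no mass to the
complement of the good set of a hard-sphere flow. [folklore] -/
theorem measure_compl_good_eq_zero_of_absolutelyContinuous {d : Type*} [Fintype d] {X : Type*}
    [MeasureSpace X] [TopologicalSpace X] {G : Geometry d X} {ε : ℝ} {n : ℕ}
    (Φ : HardSphereFlow G ε n) {P : Measure (Config n d X)} (hP : P ≪ liouville G n ε) :
    P Φ.goodᶜ = 0 :=
  hP Φ.measure_compl_good

/-! ### Pinned entropy along the deterministic flow -/

/-- **Pinned entropy.** For finite laws `P, Q` on hard-sphere phase space, both absolutely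
continuous with respect to the Liouville measure, and a hard-sphere flow `Φ` leaving `Q` invariant
(`(Φ_t)_* Q = Q`), the relative entropy of the time-evolved law is that of the initial law:
`KL((Φ_t)_* P ‖ Q) = KL(P ‖ Q)`. Proof: `KL((Φ_t)_* P ‖ Q) = KL((Φ_t)_* P ‖ (Φ_t)_* Q)` and `Φ_{-t}`
is a measurable left inverse of `Φ_t` on the good set, which carries both laws.
[cite: OllaVaradhanYau1993, §3] -/
theorem klDiv_map_flow_eq_of_map_flow_eq {d : Type*} [Fintype d] {X : Type*} [MeasureSpace X]
    [TopologicalSpace X] {G : Geometry d X} {ε : ℝ} {n : ℕ} (Φ : HardSphereFlow G ε n)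
    (P Q : Measure (Config n d X)) [IsFiniteMeasure P] [IsFiniteMeasure Q]
    (hP : P ≪ liouville G n ε) (hQ : Q ≪ liouville G n ε) (t : ℝ)
    (hQinv : Q.map (Φ.flow t) = Q) :
    klDiv (P.map (Φ.flow t)) Q = klDiv P Q := by
  conv_lhs => rw [← hQinv]
  exact Literature.MathematicalPhysics.StatisticalMechanics.klDiv_map_eq_of_leftInvOn
    (Φ.measurable_flow t) (Φ.measurable_flow (-t)) Φ.measurableSet_good
    (measure_compl_good_eq_zero_of_absolutelyContinuous Φ hP)
    (measure_compl_good_eq_zero_of_absolutelyContinuous Φ hQ)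
    (fun z hz => Φ.flow_neg_flow t hz)

/-- **`EntropyConservation`** (card `dyson-around-lambertian`, first lemma (b)): the relative
entropy of the deterministically evolved local Gibbs law with respect to the HOMOGENEOUS Gibbs law
`G_N = localGibbsLaw σ a u θ` (constant profiles; invariant under every hard-sphere flow,
`map_flow_localGibbsLaw_const`) does not depend on time:
`H((Φ_t)_* P_N | G_N) = H(P_N | G_N)`, for continuous positive profiles, `a, θ > 0` and
`σ ≤ 1/2` (all laws are then probability measures). [cite: OllaVaradhanYau1993, §3] -/
theorem klDiv_map_flow_localGibbsLaw_const {σ : ℝ} (hσ : σ ≤ 1 / 2) {a₀ θ₀ : T3 → ℝ}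
    {u₀ : T3 → V3} (ha : Continuous a₀) (hθ : Continuous θ₀) (hu : Continuous u₀)
    (ha0 : ∀ x, 0 < a₀ x) (hθ0 : ∀ x, 0 < θ₀ x) {a θ : ℝ} (ha' : 0 < a) (hθ' : 0 < θ) (u : V3)
    (N : ℕ) (Φ : HardSphereFlow (Torus.geometry (Fin 3)) (hsDiameter σ N) (N + 1)) (t : ℝ) :
    klDiv ((localGibbsLaw σ a₀ u₀ θ₀ N Φ).map (Φ.flow t))
        (localGibbsLaw σ (fun _ => a) (fun _ => u) (fun _ => θ) N Φ) =
      klDiv (localGibbsLaw σ a₀ u₀ θ₀ N Φ)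
        (localGibbsLaw σ (fun _ => a) (fun _ => u) (fun _ => θ) N Φ) := by
  haveI := isProbabilityMeasure_localGibbsLaw ha hθ hu ha0 hθ0 hσ N Φ
  haveI := isProbabilityMeasure_localGibbsLaw (a₀ := fun _ => a) (θ₀ := fun _ => θ)
    (u₀ := fun _ => u) continuous_const continuous_const continuous_const (fun _ => ha')
    (fun _ => hθ') hσ N Φ
  refine klDiv_map_flow_eq_of_map_flow_eq Φ _ _ ?_ ?_ t (map_flow_localGibbsLaw_const σ a θ u N Φ t)
  · rw [localGibbsLaw_eq]; exact localGibbsMeasure_absolutelyContinuous σ a₀ u₀ θ₀ N Φ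
  · rw [localGibbsLaw_eq]; exact localGibbsMeasure_absolutelyContinuous σ _ _ _ N Φ

/-! ### The equilibrium transfer: the entropy inequality along the flow -/

/-- **`RemainderTransfer` / `EquilibriumTransfer`, bounded form** (cards `dyson-around-lambertian`
(a) and `equilibrium-superexponential-transfer`): for probability laws `P, Q ≪ Liouville` with
`Q` invariant under the hard-sphere flow `Φ` and `KL(P ‖ Q) < ∞`, every bounded measurable
observable `Y` and every `λ > 0`,
`∫ Y(Φ_t z) dP ≤ λ⁻¹ · (KL(P ‖ Q) + log ∫ e^{λ Y} dQ)`: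
the only way the deterministically evolved law enters is through its (pinned) entropy; everything
else is an exponential moment under the invariant law. Proof: the Gibbs / Donsker–Varadhan
inequality (`integral_le_toReal_klDiv_add_log`) for the image law `(Φ_t)_* P` and the test function
`λ Y`, plus `klDiv_map_flow_eq_of_map_flow_eq`. [cite: KipnisLandim1999, Appendix 1 §8] -/
theorem integral_comp_flow_le_of_klDiv {d : Type*} [Fintype d] {X : Type*} [MeasureSpace X]
    [TopologicalSpace X] {G : Geometry d X} {ε : ℝ} {n : ℕ} (Φ : HardSphereFlow G ε n)
    (P Q : Measure (Config n d X)) [IsProbabilityMeasure P] [IsProbabilityMeasure Q]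
    (hP : P ≪ liouville G n ε) (hQ : Q ≪ liouville G n ε) (t : ℝ)
    (hQinv : Q.map (Φ.flow t) = Q) (hfin : klDiv P Q ≠ ∞) {Y : Config n d X → ℝ}
    (hY : Measurable Y) {B : ℝ} (hYb : ∀ z, |Y z| ≤ B) {lam : ℝ} (hlam : 0 < lam) :
    ∫ z, Y (Φ.flow t z) ∂P ≤
      lam⁻¹ * ((klDiv P Q).toReal + Real.log (∫ z, Real.exp (lam * Y z) ∂Q)) := by
  haveI : IsProbabilityMeasure (P.map (Φ.flow t)) :=
    Measure.isProbabilityMeasure_map (Φ.measurable_flow t).aemeasurable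
  have hfin' : klDiv (P.map (Φ.flow t)) Q ≠ ∞ := by
    rwa [klDiv_map_flow_eq_of_map_flow_eq Φ P Q hP hQ t hQinv]
  have hψ : Measurable fun z => lam * Y z := measurable_const.mul hY
  have hψb : ∀ z, |lam * Y z| ≤ lam * B := fun z => by
    rw [abs_mul, abs_of_pos hlam]
    exact mul_le_mul_of_nonneg_left (hYb z) hlam.le
  have h := Literature.Probability.Divergences.integral_le_toReal_klDiv_add_log hfin' hψ hψb
  rw [klDiv_map_flow_eq_of_map_flow_eq Φ P Q hP hQ t hQinv,
    integral_map (Φ.measurable_flow t).aemeasurable hψ.aestronglyMeasurable, integral_const_mul] at h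
  rw [le_inv_mul_iff₀ hlam]
  exact h

/-- The same for the local Gibbs law against the homogeneous Gibbs law `G_N` (constant profiles
`a, θ > 0`, `u`; `σ ≤ 1/2`): for bounded measurable `Y` and `λ > 0`,
`E_{P_N}[Y ∘ Φ_t] ≤ λ⁻¹ (H(P_N | G_N) + log E_{G_N} e^{λ Y})` as soon as `H(P_N | G_N) < ∞`.
[cite: KipnisLandim1999, Appendix 1 §8] -/
theorem integral_comp_flow_localGibbsLaw_le {σ : ℝ} (hσ : σ ≤ 1 / 2) {a₀ θ₀ : T3 → ℝ}
    {u₀ : T3 → V3} (ha : Continuous a₀) (hθ : Continuous θ₀) (hu : Continuous u₀)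
    (ha0 : ∀ x, 0 < a₀ x) (hθ0 : ∀ x, 0 < θ₀ x) {a θ : ℝ} (ha' : 0 < a) (hθ' : 0 < θ) (u : V3)
    (N : ℕ) (Φ : HardSphereFlow (Torus.geometry (Fin 3)) (hsDiameter σ N) (N + 1)) (t : ℝ)
    (hfin : klDiv (localGibbsLaw σ a₀ u₀ θ₀ N Φ)
      (localGibbsLaw σ (fun _ => a) (fun _ => u) (fun _ => θ) N Φ) ≠ ∞)
    {Y : Config (N + 1) (Fin 3) T3 → ℝ} (hY : Measurable Y) {B : ℝ} (hYb : ∀ z, |Y z| ≤ B)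
    {lam : ℝ} (hlam : 0 < lam) :
    ∫ z, Y (Φ.flow t z) ∂(localGibbsLaw σ a₀ u₀ θ₀ N Φ) ≤
      lam⁻¹ * ((klDiv (localGibbsLaw σ a₀ u₀ θ₀ N Φ)
          (localGibbsLaw σ (fun _ => a) (fun _ => u) (fun _ => θ) N Φ)).toReal +
        Real.log (∫ z, Real.exp (lam * Y z)
          ∂(localGibbsLaw σ (fun _ => a) (fun _ => u) (fun _ => θ) N Φ))) := by
  haveI := isProbabilityMeasure_localGibbsLaw ha hθ hu ha0 hθ0 hσ N Φ
  haveI := isProbabilityMeasure_localGibbsLaw (a₀ := fun _ => a) (θ₀ := fun _ => θ)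
    (u₀ := fun _ => u) continuous_const continuous_const continuous_const (fun _ => ha')
    (fun _ => hθ') hσ N Φ
  refine integral_comp_flow_le_of_klDiv Φ _ _ ?_ ?_ t (map_flow_localGibbsLaw_const σ a θ u N Φ t)
    hfin hY hYb hlam
  · rw [localGibbsLaw_eq]; exact localGibbsMeasure_absolutelyContinuous σ a₀ u₀ θ₀ N Φ
  · rw [localGibbsLaw_eq]; exact localGibbsMeasure_absolutelyContinuous σ _ _ _ N Φ

end Summit.AtomisticToContinuum.HydrodynamicLimit.Theorems
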